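import Literature.Probability.Percolation.LatticeWalksGM
import Literature.Probability.Percolation.FiniteEnergy
import Literature.Probability.Percolation.InequalitiesProofs
import Literature.Probability.Percolation.RSW
import HarnessLib

/-!
# A U of open box crossings catches every open path leaving a half-box (bond percolation on `ℤ²`)

Topic `Literature/Probability/Percolation`; proofs only (no definition, no named fact).

The deterministic half of the *gluing* arguments for crossing events near a straight boundary
(P. Nolin, *Near-critical percolation in two dimensions*, EJP 13 (2008), §4.6 "Arms in the
half-plane" with §4.3, proof of Prop. 12 (i) [arXiv 0711.4948: Prop. 11]: "it suffices to glue
crossings with circuits in annuli, using FKG"; in a half-plane the circuits become half-circuits,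
here U's made of three box crossings; G. Grimmett, *Percolation* (1999), §11.7, Fig. 11.27),
written ONCE for an abstract pair of integer coordinates `X, Y : ℤ² → ℤ` that move by at most one
along every edge of `ℤ²` and are the real and imaginary parts (up to a scale `κ > 0`) of an
isoradial rhombic drawing `emb` of `ℤ²`, so that the tree's planar crossing lemma
`exists_common_vertex_of_openCrossing` applies. The two instances used in the tree are the axis
coordinates `(v₀, v₁)` (drawing `squareLatticeEmbedding = √2 ℤ²`) and the diagonal coordinates
`(v₀ - v₁, v₀ + v₁)` (drawing `G_{0,π/2}`, `TrackExchange.zDia`): the half-planes `{v₁ ≥ 0}` and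
`{v₀ + v₁ ≥ 0}` of `ℤ²` with their sup-norm, resp. `ℓ¹`-norm, half-boxes.

Notation (local to this file; `b : Site 2` a base point with `Y b ≥ 0`, all bounds integers):
* `ν[b, v] = max |X v - X b| (Y v - Y b)` — the half-plane "norm" of `v` seen from `b`;
* `box[A₁, A₂, B₁, B₂] = {A₁ ≤ X ≤ A₂, B₁ ≤ Y ≤ B₂}`; `LR[…]`, `TB[…]` its open left–right /
  top–bottom crossings between the exact sides (`openCrossing`); `LRf[…]`, `TBf[…]` the fuzzy
  crossing events of the Russo–Seymour–Welsh inputs (`embRectCrossing`-style slack `2`);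
* `ann[b, r, R] = {0 ≤ Y, r ≤ ν[b, ·] ≤ R}` (upper half-annulus); `Ubox[b, a] = box[X b - 2a, X b + 2a, 0, Y b + 2a]`.

Contents: `norm_le_of_adj` (the norm is `1`-Lipschitz along edges), finiteness / measurability /
locality of the events, `meet` (the planar crossing lemma in the integer coordinates),
`lr_of_fuzzy` / `tb_of_fuzzy` (exact box crossings inside fuzzy ones, by clipping), and
`uCatch` / `glue` — **on the event that the two pillars `{X b + a ≤ X ≤ X b + 2a} × {0 ≤ Y ≤ Y b + 2a}`,
`{X b - 2a ≤ X ≤ X b - a} × {0 ≤ Y ≤ Y b + 2a}` are crossed from top to bottom and the bar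
`{|X - X b| ≤ 2a} × {Y b + a ≤ Y ≤ Y b + 2a}` from left to right by open paths, every open path of
the half-plane from `ν[b, ·] ≤ a` to `ν[b, ·] ≥ 2a` is joined to the U, hence any two such paths
are joined to each other.** The probabilistic consequences (Harris–FKG, RSW) are in
`HalfPlaneCrossingGluing.lean` and `HalfPlaneOneArmQuasiMultiplicativity.lean`.
-/

noncomputable section

namespace Literature.Probability.Percolation

open MeasureTheory Set LatticeModels

namespace HalfPlaneArm

variable {F : Type*} {emb : RhombicEmbedding (zdGraph 2) F} {κ : ℝ} {X Y : Site 2 → ℤ}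

local notation3 "ν[" b ", " v "]" => max |X v - X b| (Y v - Y b)
local notation3 "box[" A₁ ", " A₂ ", " B₁ ", " B₂ "]" =>
  {v : Site 2 | A₁ ≤ X v ∧ X v ≤ A₂ ∧ B₁ ≤ Y v ∧ Y v ≤ B₂}
local notation3 "LR[" A₁ ", " A₂ ", " B₁ ", " B₂ "]" =>
  openCrossing box[A₁, A₂, B₁, B₂] {v : Site 2 | X v = A₁} {v : Site 2 | X v = A₂}
local notation3 "TB[" A₁ ", " A₂ ", " B₁ ", " B₂ "]" =>
  openCrossing box[A₁, A₂, B₁, B₂] {v : Site 2 | Y v = B₁} {v : Site 2 | Y v = B₂}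
local notation3 "LRf[" A ", " B ", " w ", " h "]" =>
  openCrossing {v : Site 2 | A - 2 ≤ X v ∧ X v ≤ A + w + 2 ∧ B ≤ Y v ∧ Y v ≤ B + h}
    {v : Site 2 | X v ≤ A} {v : Site 2 | A + w ≤ X v}
local notation3 "TBf[" A ", " B ", " w ", " h "]" =>
  openCrossing {v : Site 2 | A ≤ X v ∧ X v ≤ A + w ∧ B - 2 ≤ Y v ∧ Y v ≤ B + h + 2}
    {v : Site 2 | Y v ≤ B} {v : Site 2 | B + h ≤ Y v}
local notation3 "ann[" b ", " r ", " R "]" =>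
  {v : Site 2 | 0 ≤ Y v ∧ r ≤ ν[b, v] ∧ ν[b, v] ≤ R}
local notation3 "Ubox[" b ", " a "]" => box[X b - 2 * a, X b + 2 * a, 0, Y b + 2 * a]
local notation3 "U[" b ", " a "]" =>
  TB[X b + a, X b + 2 * a, 0, Y b + 2 * a] ∩ LR[X b - 2 * a, X b + 2 * a, Y b + a, Y b + 2 * a] ∩
    TB[X b - 2 * a, X b - a, 0, Y b + 2 * a]

/-! ### Coordinates moving by at most one along the edges -/

section Lipschitz

variable (hX : ∀ u v, (zdGraph 2).Adj u v → X v ≤ X u + 1) (hY : ∀ u v, (zdGraph 2).Adj u v → Y v ≤ Y u + 1)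
include hX hY

/-- The half-plane norm moves by at most one along an edge. [folklore] -/
theorem norm_le_of_adj (b u v : Site 2) (h : (zdGraph 2).Adj u v) : ν[b, v] ≤ ν[b, u] + 1 := by
  have h1 := hX u v h
  have h2 := hX v u h.symm
  have h3 := hY u v h
  have hxu : |X u - X b| ≤ ν[b, u] := le_max_left _ _
  have hyu : Y u - Y b ≤ ν[b, u] := le_max_right _ _
  have habs := abs_le.1 hxu
  refine max_le ?_ (by omega)
  rw [abs_le]; constructor <;> omega

omit hX in
/-- `-Y` moves by at most one along an edge. [folklore] -/
theorem neg_Y_le_of_adj (u v : Site 2) (h : (zdGraph 2).Adj u v) : -Y v ≤ -Y u + 1 := by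
  have := hY v u h.symm; omega

omit hY in
/-- `-X` moves by at most one along an edge. [folklore] -/
theorem neg_X_le_of_adj (u v : Site 2) (h : (zdGraph 2).Adj u v) : -X v ≤ -X u + 1 := by
  have := hX v u h.symm; omega

end Lipschitz

/-! ### Finiteness and measurability of the events -/

section Finite

variable (hInj : Function.Injective fun v : Site 2 => (X v, Y v))
include hInj

/-- A coordinate box contains finitely many sites. [folklore] -/
theorem box_finite (A₁ A₂ B₁ B₂ : ℤ) : (box[A₁, A₂, B₁, B₂]).Finite := by
  have hsub : box[A₁, A₂, B₁, B₂] ⊆ (fun v : Site 2 => (X v, Y v)) ⁻¹' (Icc (A₁, B₁) (A₂, B₂)) := by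
    intro v hv
    simp only [mem_preimage, mem_Icc, Prod.mk_le_mk]
    exact ⟨⟨hv.1, hv.2.2.1⟩, hv.2.1, hv.2.2.2⟩
  exact ((finite_Icc _ _).preimage hInj.injOn).subset hsub

/-- The upper half-annulus is finite. [folklore] -/
theorem ann_finite (b : Site 2) (r R : ℤ) : (ann[b, r, R]).Finite := by
  refine (box_finite hInj (X b - R) (X b + R) 0 (Y b + R)).subset fun v hv => ?_
  obtain ⟨h0, -, hR⟩ := hv
  rw [max_le_iff, abs_le] at hR
  exact ⟨by omega, by omega, h0, by omega⟩

end Finite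

/-- An open crossing event of a finite region is measurable. [folklore] -/
theorem measurableSet_openCrossing_of_finite {S : Set (Site 2)} (hS : S.Finite) (A B : Set (Site 2)) :
    MeasurableSet (openCrossing S A B) := by
  rw [← hS.coe_toFinset]; exact measurableSet_openCrossing _ _ _

/-- An open crossing event of a finite region is determined by the pairs of sites of the region.
[folklore] -/
theorem determinedBy_openCrossing_of_finite {S : Set (Site 2)} (hS : S.Finite) (A B : Set (Site 2)) :
    DeterminedBy (openCrossing S A B) {e : Sym2 (Site 2) | ∀ x ∈ e, x ∈ S} := by
  classical
  have h := PlanarDuality.determinedBy_openCrossing hS.toFinset A B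
  rw [hS.coe_toFinset] at h
  refine h.mono ?_   -- wrong direction? `DeterminedBy.mono : F ⊆ F' → DeterminedBy A F → DeterminedBy A F'`
  intro e he
  rw [Finset.mem_coe, Finset.mem_sym2_iff] at he
  exact fun x hx => by simpa using he x hx

/-! ### The planar crossing lemma in the integer coordinates -/

section Meet

variable (hiso : emb.IsIsoradial) (hrh : emb.IsRhombicTiling) (hκ : 0 < κ)
  (hre : ∀ v, (emb.z v).re = κ * X v) (him : ∀ v, (emb.z v).im = κ * Y v)
include hiso hrh hκ hre him

/-- **Crossing open paths meet** (the tree's `exists_common_vertex_of_openCrossing` for the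
isoradial rhombic drawing `emb`, read in the integer coordinates `X = re / κ`, `Y = im / κ`): an
open left–right crossing of a horizontal strip `{c₁ ≤ Y ≤ c₂}` from `{X ≤ a₁}` to `{a₂ ≤ X}` and
an open bottom–top crossing of the vertical strip `{a₁ ≤ X ≤ a₂}` from `{Y ≤ c₁}` to `{c₂ ≤ Y}`
pass through a common vertex, joined inside the respective regions to all four sides.
[cite: GrimmettManolescu2014Isoradial, §2.3 (Harris–FKG reduction)] -/
theorem meet {ω : BondConfig (Site 2)} (hω : ω ⊆ (zdGraph 2).edgeSet)
    {S A B S' A' B' : Set (Site 2)} {a₁ a₂ c₁ c₂ : ℤ} (ha : a₁ < a₂) (hc : c₁ < c₂)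
    (hS : ∀ v ∈ S, c₁ ≤ Y v ∧ Y v ≤ c₂) (hA : ∀ v ∈ A, X v ≤ a₁) (hB : ∀ v ∈ B, a₂ ≤ X v)
    (hS' : ∀ v ∈ S', a₁ ≤ X v ∧ X v ≤ a₂) (hA' : ∀ v ∈ A', Y v ≤ c₁) (hB' : ∀ v ∈ B', c₂ ≤ Y v)
    (h₁ : ω ∈ openCrossing S A B) (h₂ : ω ∈ openCrossing S' A' B') :
    ∃ v, v ∈ S ∧ v ∈ S' ∧ (∃ x ∈ A, ω ∈ openConnIn S x v) ∧ (∃ y ∈ B, ω ∈ openConnIn S v y) ∧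
      (∃ x' ∈ A', ω ∈ openConnIn S' x' v) ∧ (∃ y' ∈ B', ω ∈ openConnIn S' v y') := by
  have cre : ∀ v (t : ℤ), X v ≤ t ↔ (emb.z v).re ≤ κ * t := fun v t => by
    rw [hre]; exact ⟨fun h => mul_le_mul_of_nonneg_left (by exact_mod_cast h) hκ.le,
      fun h => by exact_mod_cast le_of_mul_le_mul_left h hκ⟩
  have cre' : ∀ v (t : ℤ), t ≤ X v ↔ κ * t ≤ (emb.z v).re := fun v t => by
    rw [hre]; exact ⟨fun h => mul_le_mul_of_nonneg_left (by exact_mod_cast h) hκ.le,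
      fun h => by exact_mod_cast le_of_mul_le_mul_left h hκ⟩
  have cim : ∀ v (t : ℤ), Y v ≤ t ↔ (emb.z v).im ≤ κ * t := fun v t => by
    rw [him]; exact ⟨fun h => mul_le_mul_of_nonneg_left (by exact_mod_cast h) hκ.le,
      fun h => by exact_mod_cast le_of_mul_le_mul_left h hκ⟩
  have cim' : ∀ v (t : ℤ), t ≤ Y v ↔ κ * t ≤ (emb.z v).im := fun v t => by
    rw [him]; exact ⟨fun h => mul_le_mul_of_nonneg_left (by exact_mod_cast h) hκ.le,
      fun h => by exact_mod_cast le_of_mul_le_mul_left h hκ⟩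
  have ha' : κ * (a₁ : ℝ) < κ * a₂ := mul_lt_mul_of_pos_left (by exact_mod_cast ha) hκ
  have hc' : κ * (c₁ : ℝ) < κ * c₂ := mul_lt_mul_of_pos_left (by exact_mod_cast hc) hκ
  exact exists_common_vertex_of_openCrossing (emb := emb) hiso hrh hω ha' hc'
    (fun v hv => ⟨(cim' v c₁).1 (hS v hv).1, (cim v c₂).1 (hS v hv).2⟩)
    (fun v hv => (cre v a₁).1 (hA v hv)) (fun v hv => (cre' v a₂).1 (hB v hv))
    (fun v hv => ⟨(cre' v a₁).1 (hS' v hv).1, (cre v a₂).1 (hS' v hv).2⟩)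
    (fun v hv => (cim v c₁).1 (hA' v hv)) (fun v hv => (cim' v c₂).1 (hB' v hv)) h₁ h₂

end Meet

/-! ### Exact box crossings from the fuzzy crossing events -/

section Clip

variable (hX : ∀ u v, (zdGraph 2).Adj u v → X v ≤ X u + 1) (hY : ∀ u v, (zdGraph 2).Adj u v → Y v ≤ Y u + 1)

include hX in
/-- **Clipping a fuzzy left–right crossing.** On a lattice configuration, an open path inside the
fuzzy box `{A - 2 ≤ X ≤ A + w' + 2, B ≤ Y ≤ B + h}` from `{X ≤ A}` to `{A + w' ≤ X}` contains,
for `w ≤ w'`, an open crossing of the exact box `{A ≤ X ≤ A + w, B ≤ Y ≤ B + h}` between its two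
vertical sides (last visit to the level `X = A`, then first visit to `X = A + w`). [folklore] -/
theorem lr_of_fuzzy {ω : BondConfig (Site 2)} (hω : ω ⊆ (zdGraph 2).edgeSet) {A B : ℤ} {w w' h : ℤ}
    (hw : 0 ≤ w) (hww' : w ≤ w') (hmem : ω ∈ LRf[A, B, w', h]) : ω ∈ LR[A, A + w, B, B + h] := by
  obtain ⟨x, hx, y, hy, hxy⟩ := hmem
  obtain ⟨x', y', hx', hy', hconn⟩ :=
    exists_openConnIn_clip hω X hX (a := A) (b := A + w) (by omega) hx (le_trans (by omega) hy) hxy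
  refine ⟨x', hx', y', hy', openConnIn_mono (fun v hv => ?_) _ _ hconn⟩
  exact ⟨hv.2.1, hv.2.2, hv.1.2.2.1, hv.1.2.2.2⟩

include hY in
/-- **Clipping a fuzzy top–bottom crossing** (the same for `Y`). [folklore] -/
theorem tb_of_fuzzy {ω : BondConfig (Site 2)} (hω : ω ⊆ (zdGraph 2).edgeSet) {A B : ℤ} {w h h' : ℤ}
    (hh : 0 ≤ h) (hhh' : h ≤ h') (hmem : ω ∈ TBf[A, B, w, h']) : ω ∈ TB[A, A + w, B, B + h] := by
  obtain ⟨x, hx, y, hy, hxy⟩ := hmem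
  obtain ⟨x', y', hx', hy', hconn⟩ :=
    exists_openConnIn_clip hω Y hY (a := B) (b := B + h) (by omega) hx (le_trans (by omega) hy) hxy
  refine ⟨x', hx', y', hy', openConnIn_mono (fun v hv => ?_) _ _ hconn⟩
  exact ⟨hv.1.1, hv.1.2.1, hv.2.1, hv.2.2⟩

end Clip

/-! ### A U of box crossings catches every path leaving a half-box -/

/-- Symmetry of `{x ↔ y in S}` (pointwise form of `openConnIn_comm`). [folklore] -/
theorem conn_symm {ω : BondConfig (Site 2)} {S : Set (Site 2)} {x y : Site 2}
    (h : ω ∈ openConnIn S x y) : ω ∈ openConnIn S y x := by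
  rwa [openConnIn_comm]

/-- Transitivity of `{x ↔ y in ·}` through a common superset. [folklore] -/
theorem conn_trans {ω : BondConfig (Site 2)} {S S' T : Set (Site 2)} {x y z : Site 2}
    (hS : S ⊆ T) (hS' : S' ⊆ T) (h : ω ∈ openConnIn S x y) (h' : ω ∈ openConnIn S' y z) :
    ω ∈ openConnIn T x z :=
  PlanarDuality.openConnIn_trans (openConnIn_mono hS _ _ h) (openConnIn_mono hS' _ _ h')

section Catch

variable (hX : ∀ u v, (zdGraph 2).Adj u v → X v ≤ X u + 1) (hY : ∀ u v, (zdGraph 2).Adj u v → Y v ≤ Y u + 1)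
  (hiso : emb.IsIsoradial) (hrh : emb.IsRhombicTiling) (hκ : 0 < κ)
  (hre : ∀ v, (emb.z v).re = κ * X v) (him : ∀ v, (emb.z v).im = κ * Y v)
include hX hY hiso hrh hκ hre him

/-- **The U catches every escaping path** (deterministic half-plane form of "glue crossings with
circuits", Nolin 2008, proof of Prop. 12 (i); in the half-plane `{Y ≥ 0}` the circuit is replaced
by a U made of three box crossings: an open top–bottom crossing of each pillar
`{X b + a ≤ X ≤ X b + 2a} × {0 ≤ Y ≤ Y b + 2a}`, `{X b - 2a ≤ X ≤ X b - a} × {0 ≤ Y ≤ Y b + 2a}` and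
an open left–right crossing of the bar `{|X - X b| ≤ 2a} × {Y b + a ≤ Y ≤ Y b + 2a}`). On a lattice
configuration, every open path of the half-plane from a site `x` with `ν[b, x] ≤ a` to a site `y`
with `ν[b, y] ≥ 2a` is joined, inside its own region together with the box
`Ubox[b, a] = {|X - X b| ≤ 2a} × {0 ≤ Y ≤ Y b + 2a}`, to the left end `xB` of the bar crossing: the
path leaves `{ν[b, ·] < 2a}` through the top of the box, where it has crossed the bar from bottom
to top, or through a side, where it has crossed a pillar from side to side, and crossing open paths
meet (`meet`); the pillars themselves meet the bar.
[cite: Nolin2008, §4.3, proof of Prop. 12 (i) (arXiv 0711.4948: Prop. 11), with §4.6] -/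
theorem uCatch {ω : BondConfig (Site 2)} (hω : ω ⊆ (zdGraph 2).edgeSet) {b : Site 2} (hb : 0 ≤ Y b)
    {a : ℤ} (ha : 1 ≤ a)
    {xB yB : Site 2} (hBar : ω ∈ openConnIn box[X b - 2 * a, X b + 2 * a, Y b + a, Y b + 2 * a] xB yB)
    (hxB : X xB = X b - 2 * a) (hyB : X yB = X b + 2 * a)
    {xR yR : Site 2} (hR : ω ∈ openConnIn box[X b + a, X b + 2 * a, 0, Y b + 2 * a] xR yR)
    (hxR : Y xR = 0) (hyR : Y yR = Y b + 2 * a)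
    {xL yL : Site 2} (hL : ω ∈ openConnIn box[X b - 2 * a, X b - a, 0, Y b + 2 * a] xL yL)
    (hxL : Y xL = 0) (hyL : Y yL = Y b + 2 * a)
    {S : Set (Site 2)} (hS : ∀ v ∈ S, 0 ≤ Y v) {x y : Site 2} (hxy : ω ∈ openConnIn S x y)
    (hx : ν[b, x] ≤ a) (hy : 2 * a ≤ ν[b, y]) :
    ω ∈ openConnIn (S ∪ Ubox[b, a]) x xB := by
  -- regions inside `T = S ∪ Ubox`
  have barU : box[X b - 2 * a, X b + 2 * a, Y b + a, Y b + 2 * a] ⊆ S ∪ Ubox[b, a] :=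
    fun v hv => Or.inr ⟨hv.1, hv.2.1, by linarith [hv.2.2.1], hv.2.2.2⟩
  have pilRU : box[X b + a, X b + 2 * a, 0, Y b + 2 * a] ⊆ S ∪ Ubox[b, a] :=
    fun v hv => Or.inr ⟨by linarith [hv.1], hv.2.1, hv.2.2.1, hv.2.2.2⟩
  have pilLU : box[X b - 2 * a, X b - a, 0, Y b + 2 * a] ⊆ S ∪ Ubox[b, a] :=
    fun v hv => Or.inr ⟨hv.1, by linarith [hv.2.1], hv.2.2.1, hv.2.2.2⟩
  -- the coordinates of `x`
  have hxX : |X x - X b| ≤ a := (le_max_left _ _).trans hx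
  have hxY : Y x - Y b ≤ a := (le_max_right _ _).trans hx
  rw [abs_le] at hxX
  -- Step 1: the path up to its first visit to the level `ν = 2a`
  obtain ⟨z, hz, h₁⟩ := exists_openConnIn_le_level hω (fun v => ν[b, v]) (norm_le_of_adj hX hY b)
    (2 * a) (show ν[b, x] ≤ 2 * a by omega) hy hxy
  have S₁T : S ∩ {v | ν[b, v] ≤ 2 * a} ⊆ S ∪ Ubox[b, a] := fun v hv => Or.inl hv.1
  have memS₁ : ∀ v ∈ S ∩ {v | ν[b, v] ≤ 2 * a}, 0 ≤ Y v ∧ (X b - 2 * a ≤ X v ∧ X v ≤ X b + 2 * a) ∧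
      Y v ≤ Y b + 2 * a := fun v hv => by
    have h1 : |X v - X b| ≤ 2 * a := (le_max_left _ _).trans hv.2
    have h2 : Y v - Y b ≤ 2 * a := (le_max_right _ _).trans hv.2
    rw [abs_le] at h1
    exact ⟨hS v hv.1, by omega, by omega⟩
  -- Step 2: the pillars meet the bar
  obtain ⟨q₁, -, -, ⟨x0, hx0, hq₁B⟩, -, ⟨x0', hx0', hq₁R⟩, -⟩ := meet hiso hrh hκ hre him hω
    (S := box[X b - 2 * a, X b + 2 * a, Y b + a, Y b + 2 * a]) (A := {xB}) (B := {yB})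
    (S' := box[X b + a, X b + 2 * a, 0, Y b + 2 * a]) (A' := {xR}) (B' := {yR})
    (a₁ := X b + a) (a₂ := X b + 2 * a) (c₁ := Y b + a) (c₂ := Y b + 2 * a) (by omega) (by omega)
    (fun v hv => hv.2.2) (fun v hv => by rw [mem_singleton_iff.1 hv]; omega)
    (fun v hv => by rw [mem_singleton_iff.1 hv]; omega) (fun v hv => ⟨hv.1, hv.2.1⟩)
    (fun v hv => by rw [mem_singleton_iff.1 hv]; omega) (fun v hv => by rw [mem_singleton_iff.1 hv]; omega)
    ⟨xB, mem_singleton _, yB, mem_singleton _, hBar⟩ ⟨xR, mem_singleton _, yR, mem_singleton _, hR⟩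
  rw [mem_singleton_iff.1 hx0] at hq₁B
  rw [mem_singleton_iff.1 hx0'] at hq₁R
  obtain ⟨q₂, -, -, ⟨x1, hx1, hq₂B⟩, -, ⟨x1', hx1', hq₂L⟩, -⟩ := meet hiso hrh hκ hre him hω
    (S := box[X b - 2 * a, X b + 2 * a, Y b + a, Y b + 2 * a]) (A := {xB}) (B := {yB})
    (S' := box[X b - 2 * a, X b - a, 0, Y b + 2 * a]) (A' := {xL}) (B' := {yL})
    (a₁ := X b - 2 * a) (a₂ := X b - a) (c₁ := Y b + a) (c₂ := Y b + 2 * a) (by omega) (by omega)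
    (fun v hv => hv.2.2) (fun v hv => by rw [mem_singleton_iff.1 hv]; omega)
    (fun v hv => by rw [mem_singleton_iff.1 hv]; omega) (fun v hv => ⟨hv.1, hv.2.1⟩)
    (fun v hv => by rw [mem_singleton_iff.1 hv]; omega) (fun v hv => by rw [mem_singleton_iff.1 hv]; omega)
    ⟨xB, mem_singleton _, yB, mem_singleton _, hBar⟩ ⟨xL, mem_singleton _, yL, mem_singleton _, hL⟩
  rw [mem_singleton_iff.1 hx1] at hq₂B
  rw [mem_singleton_iff.1 hx1'] at hq₂L
  -- Step 3: where does the path reach the level `ν = 2a`?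
  have hz' : Y z - Y b = 2 * a ∨ |X z - X b| = 2 * a := by
    rcases le_total (|X z - X b|) (Y z - Y b) with h | h
    · left; rwa [max_eq_right h] at hz
    · right; rwa [max_eq_left h] at hz
  rcases hz' with htop | hside
  · -- through the top: the path crosses the bar from bottom to top
    obtain ⟨x₁, hx₁, h₂⟩ := exists_openConnIn_ge_level hω Y hY (Y b + a) (show Y x ≤ Y b + a by omega)
      (show Y b + a ≤ Y z by omega) h₁
    obtain ⟨m, -, -, ⟨x2, hx2, hmB⟩, -, -, ⟨y2, hy2, hmz⟩⟩ := meet hiso hrh hκ hre him hω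
      (S := box[X b - 2 * a, X b + 2 * a, Y b + a, Y b + 2 * a]) (A := {xB}) (B := {yB})
      (S' := S ∩ {v | ν[b, v] ≤ 2 * a} ∩ {v | Y b + a ≤ Y v}) (A' := {x₁}) (B' := {z})
      (a₁ := X b - 2 * a) (a₂ := X b + 2 * a) (c₁ := Y b + a) (c₂ := Y b + 2 * a) (by omega) (by omega)
      (fun v hv => hv.2.2) (fun v hv => by rw [mem_singleton_iff.1 hv]; omega)
      (fun v hv => by rw [mem_singleton_iff.1 hv]; omega) (fun v hv => (memS₁ v hv.1).2.1)
      (fun v hv => by rw [mem_singleton_iff.1 hv]; omega) (fun v hv => by rw [mem_singleton_iff.1 hv]; omega)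
      ⟨xB, mem_singleton _, yB, mem_singleton _, hBar⟩ ⟨x₁, mem_singleton _, z, mem_singleton _, h₂⟩
    rw [mem_singleton_iff.1 hx2] at hmB
    rw [mem_singleton_iff.1 hy2] at hmz
    -- `x ↔ z ↔ m ↔ xB`
    exact conn_trans subset_rfl barU
      (conn_trans S₁T (fun v hv => S₁T hv.1) h₁ (conn_symm hmz)) (conn_symm hmB)
  · have hside' : X z = X b + 2 * a ∨ X z = X b - 2 * a := by
      rcases (abs_eq (show (0 : ℤ) ≤ 2 * a by omega)).1 hside with h | h
      · left; omega
      · right; omega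
    rcases hside' with hr | hl
    · -- through the right side: the path crosses the right pillar from left to right
      obtain ⟨x₁, hx₁, h₂⟩ := exists_openConnIn_ge_level hω X hX (X b + a) (show X x ≤ X b + a by omega)
        (show X b + a ≤ X z by omega) h₁
      obtain ⟨m, -, -, -, ⟨y2, hy2, hmz⟩, ⟨x2, hx2, hmR⟩, -⟩ := meet hiso hrh hκ hre him hω
        (S := S ∩ {v | ν[b, v] ≤ 2 * a} ∩ {v | X b + a ≤ X v}) (A := {x₁}) (B := {z})
        (S' := box[X b + a, X b + 2 * a, 0, Y b + 2 * a]) (A' := {xR}) (B' := {yR})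
        (a₁ := X b + a) (a₂ := X b + 2 * a) (c₁ := 0) (c₂ := Y b + 2 * a) (by omega) (by omega)
        (fun v hv => ⟨(memS₁ v hv.1).1, (memS₁ v hv.1).2.2⟩)
        (fun v hv => by rw [mem_singleton_iff.1 hv]; omega)
        (fun v hv => by rw [mem_singleton_iff.1 hv]; omega) (fun v hv => ⟨hv.1, hv.2.1⟩)
        (fun v hv => by rw [mem_singleton_iff.1 hv]; omega) (fun v hv => by rw [mem_singleton_iff.1 hv]; omega)
        ⟨x₁, mem_singleton _, z, mem_singleton _, h₂⟩ ⟨xR, mem_singleton _, yR, mem_singleton _, hR⟩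
      rw [mem_singleton_iff.1 hy2] at hmz
      rw [mem_singleton_iff.1 hx2] at hmR
      -- `x ↔ z ↔ m ↔ xR ↔ q₁ ↔ xB`
      refine conn_trans subset_rfl barU ?_ (conn_symm hq₁B)
      refine conn_trans subset_rfl pilRU ?_ hq₁R
      refine conn_trans subset_rfl pilRU ?_ (conn_symm hmR)
      exact conn_trans S₁T (fun v hv => S₁T hv.1) h₁ (conn_symm hmz)
    · -- through the left side: the path crosses the left pillar from right to left
      obtain ⟨x₁, hx₁, h₂⟩ := exists_openConnIn_ge_level hω (fun v => -X v) (neg_X_le_of_adj hX)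
        (-(X b - a)) (show -X x ≤ -(X b - a) by omega) (show -(X b - a) ≤ -X z by omega) h₁
      obtain ⟨m, -, -, ⟨x2, hx2, hzm⟩, -, ⟨x3, hx3, hmL⟩, -⟩ := meet hiso hrh hκ hre him hω
        (S := S ∩ {v | ν[b, v] ≤ 2 * a} ∩ {v | -(X b - a) ≤ -X v}) (A := {z}) (B := {x₁})
        (S' := box[X b - 2 * a, X b - a, 0, Y b + 2 * a]) (A' := {xL}) (B' := {yL})
        (a₁ := X b - 2 * a) (a₂ := X b - a) (c₁ := 0) (c₂ := Y b + 2 * a) (by omega) (by omega)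
        (fun v hv => ⟨(memS₁ v hv.1).1, (memS₁ v hv.1).2.2⟩)
        (fun v hv => by rw [mem_singleton_iff.1 hv]; omega)
        (fun v hv => by rw [mem_singleton_iff.1 hv]; omega) (fun v hv => ⟨hv.1, hv.2.1⟩)
        (fun v hv => by rw [mem_singleton_iff.1 hv]; omega) (fun v hv => by rw [mem_singleton_iff.1 hv]; omega)
        ⟨z, mem_singleton _, x₁, mem_singleton _, conn_symm h₂⟩ ⟨xL, mem_singleton _, yL, mem_singleton _, hL⟩
      rw [mem_singleton_iff.1 hx2] at hzm
      rw [mem_singleton_iff.1 hx3] at hmL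
      -- `x ↔ z ↔ m ↔ xL ↔ q₂ ↔ xB`
      refine conn_trans subset_rfl barU ?_ (conn_symm hq₂B)
      refine conn_trans subset_rfl pilLU ?_ hq₂L
      refine conn_trans subset_rfl pilLU ?_ (conn_symm hmL)
      exact conn_trans S₁T (fun v hv => S₁T hv.1) h₁ hzm

/-- **Two escaping paths are glued by the U.** On a lattice configuration in the event `U[b, a]`
(the three box crossings of `uCatch`), two open paths of the half-plane, each from `ν[b, ·] ≤ a` to
`ν[b, ·] ≥ 2a`, have their starting points joined inside the union of their regions and `Ubox[b, a]`.
[cite: Nolin2008, §4.3, proof of Prop. 12 (i) (arXiv 0711.4948: Prop. 11), with §4.6] -/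
theorem glue {ω : BondConfig (Site 2)} (hω : ω ⊆ (zdGraph 2).edgeSet) {b : Site 2} (hb : 0 ≤ Y b)
    {a : ℤ} (ha : 1 ≤ a) (hU : ω ∈ U[b, a])
    {S : Set (Site 2)} (hS : ∀ v ∈ S, 0 ≤ Y v) {x y : Site 2} (hxy : ω ∈ openConnIn S x y)
    (hx : ν[b, x] ≤ a) (hy : 2 * a ≤ ν[b, y])
    {S' : Set (Site 2)} (hS' : ∀ v ∈ S', 0 ≤ Y v) {x' y' : Site 2} (hxy' : ω ∈ openConnIn S' x' y')
    (hx' : ν[b, x'] ≤ a) (hy' : 2 * a ≤ ν[b, y']) :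
    ω ∈ openConnIn (S ∪ S' ∪ Ubox[b, a]) x x' := by
  obtain ⟨⟨⟨xR, hxR, yR, hyR, hR⟩, ⟨xB, hxB, yB, hyB, hBar⟩⟩, ⟨xL, hxL, yL, hyL, hL⟩⟩ := hU
  have h1 := uCatch hX hY hiso hrh hκ hre him hω hb ha hBar hxB hyB hR hxR hyR hL hxL hyL hS hxy hx hy
  have h2 := uCatch hX hY hiso hrh hκ hre him hω hb ha hBar hxB hyB hR hxR hyR hL hxL hyL hS' hxy' hx' hy'
  refine conn_trans (union_subset_union_left _ subset_union_left)
    (union_subset_union_left _ subset_union_right) h1 (conn_symm h2)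

end Catch

end HalfPlaneArm

end Literature.Probability.Percolation
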